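import Summits.HubbardSuperconductivity.HubbardSuperconductivity.Theses.CooperPairDMottWalk
import Summits.HubbardSuperconductivity.HubbardSuperconductivity.Theorems.CooperPairDMottWalkCooperPairDMottTwoHoleGapMomentum
import Summits.HubbardSuperconductivity.HubbardSuperconductivity.Theorems.CooperPairDMottWalkCooperPairDMottPairTrialCeilingBreathing
import Literature.MathematicalPhysics.QuantumLattice.PlaquetteBreathingSpaceGroup

/-!
# Route `CooperPairDMottWalk`, crux `CooperPairDMott` (stmt-HubbardSuperconductivity-1177):
# stub `stub_twoHoleGapOrthogonal` (U′) reduced to the two engine statements (E1), (E2)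

Stub U′ of the registered skeleton `Cruxes/CooperPairDMott/Lines/birth.lean` is clause (b) of the crux
in spectral form: for `U ∈ [2,4]`, small `b > 0` and all large `L = 4k+4`, a vector `Ω` and a level
`E₁ > E(L²−2, 0)` with `Re⟨ψ, Hb ψ⟩ ≥ E₁ ‖ψ‖²` on the part of the `(L²−2, S^z = 0)` sector of the
breathing torus `Hb L 1 b U` orthogonal to `Ω` (the hypothesis of
`uniqueTwoHoleGroundState_of_gap_orthogonal`). The pair-band picture (Yao–Tsai–Kivelson 2007): the
`(L/2)²` one-plaquette pair states are degenerate at `b = 0` and split at order `b²` into a band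
`E(K)` over the plaquette momenta `K`, whose bottom is simple on the EVEN plaquette torus; the gap
above it closes like `b²/L²`, so the estimate must be resolved by the plaquette momentum and by an
`L`-uniform (local) effective Hamiltonian — the missing engine. This file lands the reduction of U′
to exactly two engine statements, by instantiating the linear algebra of `…TwoHoleGapSchur`
(Schur complement), `…TwoHoleGapBlocks` (symmetry blocks, one trial vector per block) and
`…TwoHoleGapMomentum` (isotypic projections and plane waves of a torus representation) with the
PLAQUETTE TRANSLATIONS `U_{2v} = fockTranslate (2 • v)` of the breathing torus (symmetries of `Hb` by
`PlaquetteBreathingSpaceGroup`, preserving the sectors):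

* `fockTranslate_two_nsmul_commute_breathing` — `[U_{2v}, Hb L a b U] = 0` for even `L` and all `v`;
* `exists_twoHoleGap_of_pairBandSchur` — at one even side `L`, couplings `(a, b, U)` and sector
  `(N, M)`: given ONE vector `Ψ₀` of the sector (the dressed pair state of the plaquette at the origin)
  with plane waves `p_K = Σ_m conj χ_K(m) U_{2m} Ψ₀`, a bottom momentum `K₀` and a level `E₁` with
  `Re⟨p_{K₀}, Hb p_{K₀}⟩ < E₁ ‖p_{K₀}‖²`, the conclusion `∃ Ω E₁, minEnergyOn < E₁ ∧ gap on Ω^⊥` follows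
  from
  (E1) COMPLEMENT / TWO-HOLON THRESHOLD: for every plaquette momentum `K`, `Hb ≥ E₁ + g_K`
    (`g_K > 0`) on the momentum-`K` vectors of the sector orthogonal to `p_K`;
  (E2) PAIR-BAND DISPERSION: for every `K ≠ K₀` the scalar Schur inequality
    `‖Hb p_K‖² ‖p_K‖² − ⟨p_K, Hb p_K⟩² ≤ (⟨p_K, Hb p_K⟩ − E₁ ‖p_K‖²) g_K ‖p_K‖²`
    (leakage × norm ≤ excess × gap; the three scalars are Fourier transforms of the kernels
    `⟨Ψ₀, A U_{2a} Ψ₀⟩`, `A = 1, Hb, Hb²`, by `planeWave_form_eq_sum`);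
* `twoHoleGapOrthogonal_of_pairBandSchur` — the same with the verbatim quantifier prefix of the
  stub (`∀ U ∈ [2,4] ∃ b₀ ∀ b ∈ (0,b₀) ∃ k₀ ∀ k ≥ k₀`): IF (E1), (E2) and the data are supplied at
  each such `(U, b, k)`, THEN `stub_twoHoleGapOrthogonal` holds verbatim.

What is NOT proved here (the engine, to be supplied uniformly in `L`): (E1) needs the two-holon
threshold `2(e₃ − e₄) − (e₂ − e₄) = Δ_p > 0` of the plaquette minus `O(b)`, i.e. relative-bound gap
stability of the fermionic block parent in the two-hole sector (the same engine as the holon floor,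
stub H); (E2) needs a dressed `Ψ₀` (Schrieffer–Wolff to an `L`-dependent order, or the exact
Feshbach vector) whose leakage `ρ_K = ‖Hb p̂_K‖² − ⟨p̂_K, Hb p̂_K⟩²` (`p̂_K = p_K/‖p_K‖`) satisfies
`ρ_K / g_K < ĥ(K) − E₁`, where the band `ĥ(K) = ⟨p̂_K, Hb p̂_K⟩` has a unique minimum `K₀` with
`ĥ(K) − ĥ(K₀) ≥ c b² dist(K, K₀)²`, `c > 0` independent of `L` — so `ρ_K = o(b²/L²)`, i.e. a dressing
of `L`-dependent order (flat-band second-order perturbation theory with locality; the sign of the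
effective pair hopping decides `K₀ ∈ {0, (π,π)}`).

References: H. Yao, W.-F. Tsai, S. A. Kivelson, PRB 76 (2007) 161104 [YaoTsaiKivelson2007];
W.-F. Tsai, S. A. Kivelson, PRB 73 (2006) 214510 [TsaiKivelson2006]; T. Kato, *Perturbation Theory
for Linear Operators* (1966) §II.2; J.-P. Serre, *Linear Representations of Finite Groups* §2.6. All
statements are [folklore]; no definition is introduced (the breathing Hamiltonian is written out, or
enters through the defining hypothesis `hHb`, verbatim the route's `Hb L a b U`).
-/

set_option linter.dupNamespace false -- the route namespace `HubbardSuperconductivity.HubbardSuperconductivity` is mandated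

noncomputable section

namespace Summit.HubbardSuperconductivity.HubbardSuperconductivity.Theorems.CooperPairDMottWalk

open Matrix Finset
open scoped ComplexOrder ComplexConjugate
open Literature.MathematicalPhysics.QuantumLattice Literature.Probability.LatticeModels
open Summit.HubbardSuperconductivity.HubbardSuperconductivity.Theses.CooperPairDMottWalk

/-! ### The plaquette translations `U_{2v}` -/

section Translations

variable {L : ℕ} [NeZero L]

/-- Coordinates of `2 • v` on the two plaquette generators `2e₀`, `2e₁` of `(ℤ/Lℤ)²`. [folklore] -/
theorem two_nsmul_eq_sum_single (v : TorusSite 2 L) :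
    (2 : ℕ) • v = (v 0).val • (Pi.single 0 ((2 : ℕ) : ZMod L) : TorusSite 2 L) +
      (v 1).val • (Pi.single 1 ((2 : ℕ) : ZMod L) : TorusSite 2 L) := by
  funext i
  rw [Pi.smul_apply, Pi.add_apply, Pi.smul_apply, Pi.smul_apply]
  fin_cases i
  · simp [ZMod.natCast_val, ZMod.cast_id']
    ring
  · simp [ZMod.natCast_val, ZMod.cast_id']
    ring

/-- `U_wᴴ = U_{-w}` on matrices (`fockTranslate_neg`). [folklore] -/
theorem fockTranslate_val_conjTranspose {d : ℕ} (w : TorusSite d L) :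
    ((fockTranslate w).val)ᴴ = (fockTranslate (-w)).val := by
  rw [fockTranslate_neg]
  rfl

/-- `U_{v+w} = U_v U_w` on matrices (`fockTranslate_add`). [folklore] -/
theorem fockTranslate_val_add {d : ℕ} (v w : TorusSite d L) :
    (fockTranslate (v + w)).val = (fockTranslate v).val * (fockTranslate w).val := by
  rw [fockTranslate_add]
  rfl

/-- An operator commuting with `U_w` commutes with `U_{m w}` for every `m : ℕ` (`U_0 = U_{id}`
commutes with everything, `relabel_refl`). [folklore] -/
theorem commute_fockTranslate_nsmul {d : ℕ}
    {A : Matrix (Finset (Orb (FermionTorus d L))) (Finset (Orb (FermionTorus d L))) ℂ}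
    {w : TorusSite d L} (h : Commute (fockTranslate w).val A) (m : ℕ) :
    Commute (fockTranslate (m • w)).val A := by
  induction m with
  | zero =>
      rw [zero_nsmul]
      exact fockRelabel_commute_of_relabel_eq _ (by rw [Orb.translate_zero, Equiv.Perm.one_def, relabel_refl])
  | succ m ih =>
      rw [succ_nsmul, fockTranslate_val_add]
      exact ih.mul_left h

/-- **The plaquette generators commute with the breathing Hamiltonian**: `[U_{2eⱼ}, Hb L a b U] = 0`
for even `L` (`PlaquetteBreathingSpaceGroup`: `plaq_spaceGroup_translate_two_single`,
`relabel_spaceGroup_breathing`). [folklore] -/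
theorem fockTranslate_two_single_commute_breathing (hL : Even L) (j : Fin 2) (a b U : ℝ) :
    Commute (fockTranslate (Pi.single j ((2 : ℕ) : ZMod L))).val
      (hamiltonian (fermionTorusGraph 2 L \ (⊤ : SimpleGraph (Fin 2 → ℕ)).comap
        (fun (x : FermionTorus 2 L) (i : Fin 2) => (ofLex x i : ℕ) / 2)) a U +
      hamiltonian (fermionTorusGraph 2 L ⊓ (⊤ : SimpleGraph (Fin 2 → ℕ)).comap
        (fun (x : FermionTorus 2 L) (i : Fin 2) => (ofLex x i : ℕ) / 2)) b 0) := by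
  have h := relabel_spaceGroup_breathing (L := L) 1 (Pi.single j ((2 : ℕ) : ZMod L))
    (plaq_spaceGroup_translate_two_single hL j) a b U
  have hc := fockRelabel_commute_of_relabel_eq _ h
  rw [← fockD4_mul_fockTranslate_val, map_one] at hc
  simpa using hc

/-- **All plaquette translations commute with the breathing Hamiltonian**: `[U_{2v}, Hb L a b U] = 0`
for even `L` and every `v ∈ (ℤ/Lℤ)²`. [folklore] -/
theorem fockTranslate_two_nsmul_commute_breathing (hL : Even L) (v : TorusSite 2 L) (a b U : ℝ) :
    Commute (fockTranslate ((2 : ℕ) • v)).val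
      (hamiltonian (fermionTorusGraph 2 L \ (⊤ : SimpleGraph (Fin 2 → ℕ)).comap
        (fun (x : FermionTorus 2 L) (i : Fin 2) => (ofLex x i : ℕ) / 2)) a U +
      hamiltonian (fermionTorusGraph 2 L ⊓ (⊤ : SimpleGraph (Fin 2 → ℕ)).comap
        (fun (x : FermionTorus 2 L) (i : Fin 2) => (ofLex x i : ℕ) / 2)) b 0) := by
  rw [two_nsmul_eq_sum_single, fockTranslate_val_add]
  exact (commute_fockTranslate_nsmul (fockTranslate_two_single_commute_breathing hL 0 a b U) _).mul_left
    (commute_fockTranslate_nsmul (fockTranslate_two_single_commute_breathing hL 1 a b U) _)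

end Translations

/-! ### The reduction of U′ to (E1) and (E2) at one size -/

section OneSize

variable {L : ℕ} [NeZero L]

/-- **The two-hole gap from (E1) and (E2), one size.** For even `L`, couplings `(a, b, U)`, a sector
`(N, M)` of the breathing torus `Hb = Hb L a b U`, a vector `Ψ₀` of the sector with plaquette plane
waves `p_K = Σ_m conj χ_K(m) U_{2m} Ψ₀` (`χ = torusChar` on `(ℤ/Lℤ)²`; only momenta trivial on the
`2`-torsion carry non-zero `p_K`), a momentum `K₀`, a level `E₁` with `Re⟨p_{K₀}, Hb p_{K₀}⟩ < E₁ ‖p_{K₀}‖²`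
and gaps `g_K > 0`: IF (E1) `(E₁ + g_K) ‖ψ‖² ≤ Re⟨ψ, Hb ψ⟩` for every `ψ` of the sector with
`U_{2w} ψ = χ_K(w) ψ` (all `w`) and `⟨p_K, ψ⟩ = 0`, for every `K`, and (E2) the scalar Schur inequality
`‖Hb p_K‖² ‖p_K‖² − ⟨p_K, Hb p_K⟩² ≤ (⟨p_K, Hb p_K⟩ − E₁ ‖p_K‖²) g_K ‖p_K‖²` for every `K ≠ K₀`, THEN
`∃ Ω E, minEnergyOn Hb (szSector N M) < E ∧ (Hb ≥ E on Ω^⊥ ∩ szSector N M)`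
(`exists_gap_orthogonal_of_translates` for the representation `v ↦ U_{2v}`; `Hb` enters through its
defining hypothesis `hHb`). [folklore] -/
theorem exists_twoHoleGap_of_pairBandSchur (hL : Even L) (a b U : ℝ)
    {Hb : Matrix (Finset (Orb (FermionTorus 2 L))) (Finset (Orb (FermionTorus 2 L))) ℂ}
    (hHb : Hb = (hamiltonian (fermionTorusGraph 2 L \ (⊤ : SimpleGraph (Fin 2 → ℕ)).comap
      (fun (x : FermionTorus 2 L) (i : Fin 2) => (ofLex x i : ℕ) / 2)) a U +
      hamiltonian (fermionTorusGraph 2 L ⊓ (⊤ : SimpleGraph (Fin 2 → ℕ)).comap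
      (fun (x : FermionTorus 2 L) (i : Fin 2) => (ofLex x i : ℕ) / 2)) b 0))
    (N : ℕ) (M : ℝ)
    {Ψ₀ : Fock (Orb (FermionTorus 2 L))} (hΨ₀ : Ψ₀ ∈ szSector (Λ := FermionTorus 2 L) N M)
    (p : TorusSite 2 L → Fock (Orb (FermionTorus 2 L)))
    (hp : ∀ K, p K = ∑ m, conj (torusChar K m) • ((fockTranslate ((2 : ℕ) • m)).val *ᵥ Ψ₀))
    (K₀ : TorusSite 2 L) (E₁ : ℝ) (g : TorusSite 2 L → ℝ) (hg : ∀ K, 0 < g K)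
    (hlt : (star (p K₀) ⬝ᵥ Hb *ᵥ p K₀).re < E₁ * (star (p K₀) ⬝ᵥ p K₀).re)
    (hE1 : ∀ K, ∀ ψ ∈ szSector (Λ := FermionTorus 2 L) N M,
      (∀ w, (fockTranslate ((2 : ℕ) • w)).val *ᵥ ψ = torusChar K w • ψ) → star (p K) ⬝ᵥ ψ = 0 →
        (E₁ + g K) * (star ψ ⬝ᵥ ψ).re ≤ (star ψ ⬝ᵥ Hb *ᵥ ψ).re)
    (hE2 : ∀ K, K ≠ K₀ →
      (star (Hb *ᵥ p K) ⬝ᵥ (Hb *ᵥ p K)).re * (star (p K) ⬝ᵥ p K).re -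
          (star (p K) ⬝ᵥ Hb *ᵥ p K).re ^ 2 ≤
        ((star (p K) ⬝ᵥ Hb *ᵥ p K).re - E₁ * (star (p K) ⬝ᵥ p K).re) * g K *
          (star (p K) ⬝ᵥ p K).re) :
    ∃ (Ω : Fock (Orb (FermionTorus 2 L))) (E : ℝ), (Hb).minEnergyOn (szSector N M) < E ∧
      ∀ ψ ∈ szSector (Λ := FermionTorus 2 L) N M, star Ω ⬝ᵥ ψ = 0 →
        E * (star ψ ⬝ᵥ ψ).re ≤ (star ψ ⬝ᵥ Hb *ᵥ ψ).re := by
  subst hHb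
  exact exists_gap_orthogonal_of_translates _ (breathing_isHermitian _ _ a b U) (szSector N M)
    (fun v => (fockTranslate ((2 : ℕ) • v)).val) (fun ψ => by simp [fockTranslate_zero])
    (fun v w => by simp only [smul_add, fockTranslate_val_add])
    (fun v => by simp only [fockTranslate_val_conjTranspose, smul_neg])
    (fun v => fockTranslate_two_nsmul_commute_breathing hL v a b U)
    (fun v ψ hψ => fockTranslate_mulVec_mem_szSector _ hψ) hΨ₀ p hp K₀ E₁ g hg hlt hE1 hE2

end OneSize

/-! ### The reduction of stub U′ (verbatim quantifier prefix) -/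

/-- **Stub U′ (`stub_twoHoleGapOrthogonal`) from the pair-band engine (E1) + (E2).** With the breathing
torus `Hb L 1 b U` of the route and the verbatim quantifier prefix of the stub
(`∀ U ∈ [2,4] ∃ b₀ ∀ b ∈ (0,b₀) ∃ k₀ ∀ k ≥ k₀`, `L = 4k+4`): IF at each such `(U, b, k)` there are a
two-hole-sector vector `Ψ₀` (the dressed pair state of the plaquette at the origin) with plaquette plane
waves `p_K`, a bottom momentum `K₀`, a level `E₁` strictly above the Rayleigh quotient of `p_{K₀}` and
gaps `g_K > 0` such that (E1) `Hb ≥ E₁ + g_K` on the momentum-`K` two-hole vectors orthogonal to `p_K`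
(all `K`) and (E2) the scalar Schur inequality of `p_K` holds for all `K ≠ K₀`, THEN the two-hole
level is isolated from its orthogonal complement — literally `stub_twoHoleGapOrthogonal`
(`exists_twoHoleGap_of_pairBandSchur` at `L = 4k+4`, `a = 1`, sector `((4k+4)² − 2, 0)`). The
hypothesis is where the missing `L`-uniform engine must deliver. [folklore] -/
theorem twoHoleGapOrthogonal_of_pairBandSchur : (let Hb := fun (L : ℕ) (a b U : ℝ) => hamiltonian (fermionTorusGraph 2 L \ (⊤ : SimpleGraph (Fin 2 → ℕ)).comap (fun (x : FermionTorus 2 L) (i : Fin 2) => (ofLex x i : ℕ) / 2)) a U + hamiltonian (fermionTorusGraph 2 L ⊓ (⊤ : SimpleGraph (Fin 2 → ℕ)).comap (fun (x : FermionTorus 2 L) (i : Fin 2) => (ofLex x i : ℕ) / 2)) b 0; ∀ U ∈ Set.Icc (2 : ℝ) 4, ∃ b₀ > (0 : ℝ), ∀ b ∈ Set.Ioo 0 b₀, ∃ k₀ : ℕ, ∀ k ≥ k₀, ∃ (Ψ₀ : Fock (Orb (FermionTorus 2 (4 * k + 4)))) (p : Literature.Probability.LatticeModels.TorusSite 2 (4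 * k + 4) → Fock (Orb (FermionTorus 2 (4 * k + 4)))) (K₀ : Literature.Probability.LatticeModels.TorusSite 2 (4 * k + 4)) (E₁ : ℝ) (g : Literature.Probability.LatticeModels.TorusSite 2 (4 * k + 4) → ℝ), Ψ₀ ∈ szSector ((4 * k + 4) ^ 2 - 2) 0 ∧ (∀ K, p K = ∑ m, starRingEnd ℂ (Literature.Probability.LatticeModels.torusChar K m) • ((fockTranslate ((2 : ℕ) • m)).val *ᵥ Ψ₀)) ∧ (∀ K, 0 < g K) ∧ (star (p K₀) ⬝ᵥ (Hb (4 * k + 4) 1 b U) *ᵥ p K₀).re < E₁ * (star (p K₀) ⬝ᵥ p K₀).re ∧ (∀ K, ∀ ψ ∈ szSector ((4 * k + 4) ^ 2 - 2) 0, (∀ w, (fockTranslate ((2 : ℕ) • w)).val *ᵥ ψ = Literature.Probability.LatticeModels.torusChar K w • ψ) → star (p K) ⬝ᵥ ψ = 0 → (E₁ + g K) * (star ψ ⬝ᵥ ψ).re ≤ (star ψ ⬝ᵥ (Hb (4 * k + 4) 1 b U) *ᵥ ψ).re) ∧ (∀ K, K ≠ K₀ → (star ((Hb (4 * k + 4)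 1 b U) *ᵥ p K) ⬝ᵥ ((Hb (4 * k + 4) 1 b U) *ᵥ p K)).re * (star (p K) ⬝ᵥ p K).re - (star (p K) ⬝ᵥ (Hb (4 * k + 4) 1 b U) *ᵥ p K).re ^ 2 ≤ ((star (p K) ⬝ᵥ (Hb (4 * k + 4) 1 b U) *ᵥ p K).re - E₁ * (star (p K) ⬝ᵥ p K).re) * g K * (star (p K) ⬝ᵥ p K).re)) → (let Hb := fun (L : ℕ) (a b U : ℝ) => hamiltonian (fermionTorusGraph 2 L \ (⊤ : SimpleGraph (Fin 2 → ℕ)).comap (fun (x : FermionTorus 2 L) (i : Fin 2) => (ofLex x i : ℕ) / 2)) a U + hamiltonian (fermionTorusGraph 2 L ⊓ (⊤ : SimpleGraph (Fin 2 → ℕ)).comap (fun (x : FermionTorus 2 L) (i : Fin 2) => (ofLex x i : ℕ) / 2)) b 0; ∀ U ∈ Set.Icc (2 : ℝ) 4, ∃ b₀ > (0 : ℝ), ∀ b ∈ Set.Ioo 0 b₀, ∃ k₀ : ℕ, ∀ k ≥ k₀, ∃ (Ω : Fock (Orb (FermionTorus 2 (4 * k + 4)))) (E₁ : ℝ), (Hb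 (4 * k + 4) 1 b U).minEnergyOn (szSector ((4 * k + 4) ^ 2 - 2) 0) < E₁ ∧ ∀ ψ ∈ szSector ((4 * k + 4) ^ 2 - 2) 0, star Ω ⬝ᵥ ψ = 0 → E₁ * (star ψ ⬝ᵥ ψ).re ≤ (star ψ ⬝ᵥ (Hb (4 * k + 4) 1 b U) *ᵥ ψ).re) := by
  intro h
  dsimp only at h ⊢
  intro U hU
  obtain ⟨b₀, hb₀, hb⟩ := h U hU
  refine ⟨b₀, hb₀, fun b hbI => ?_⟩
  obtain ⟨k₀, hk⟩ := hb b hbI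
  refine ⟨k₀, fun k hkk => ?_⟩
  obtain ⟨Ψ₀, p, K₀, E₁, g, hΨ₀, hp, hg, hlt, hE1, hE2⟩ := hk k hkk
  have hL : Even (4 * k + 4) := ⟨2 * k + 2, by ring⟩
  exact exists_twoHoleGap_of_pairBandSchur hL 1 b U rfl _ _ hΨ₀ p hp K₀ E₁ g hg hlt hE1 hE2

end Summit.HubbardSuperconductivity.HubbardSuperconductivity.Theorems.CooperPairDMottWalk

end
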